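import Summits.QuantumFields.BalabanUV.T4Continuum.Support.NE7EnergySliceFullGaugeSplit
import HarnessLib

/-!
# NE7NestedCovariantExtension — THE SPIKE-FREE SLICE GAUGE FUNCTION, PART 1 (memo ROAD-G100 §2.4 (i)–(ii), inventory (GF)): the NESTED COVARIANT BLOCK-CONSTANT
# EXTENSION `nestedExt L k W g` of coarse data `g` through the tower (one transported `L`-block-constant extension per level, at the successive averaged backgrounds
# `W, cavg L W, …`) has nested transported block mean EXACTLY `g` (`bmeanIterW L k W (nestedExt L k W g) = g` — NO inversion, NO spike), sup norm `≤ sup‖g‖`, is skew and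
# periodic with `g`; hence the LINEAR `𝒯_E`-SPLIT over the full gauge group for every direction whose `(k+1)`-fold linearised average is a coarse pure gauge,
# `dirIter L (j+1) W T = gaugeDir_V h` ⟹ `T = Ỹ + gaugeDir W ζ`, `Ỹ ∈ 𝒯_E(W)`, WITH the spike-free gauge function `ζ = −(ζ₁ + η)`, `ζ₁ = nestedExt (framePotW T − h)`,
# `sup‖ζ₁‖ ≤ sup‖framePotW T − h‖`, `η ∈ Ξ_Q(W)`, `gaugeDir W η = Ỹ − T − gaugeDir W ζ₁` (the socket of the sup Poincaré letter `NE7MeanZeroGaugeSupPoincare`)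

Cell `pub-balaban`, rung (B)+1 sub-cell t4, lineage `b2b-balaban-t4-ne7-p1`, generation 100 (CRUX PROVER NE7 #1 = OWNER of BINDER row NE7).  Memo `t4/b2b-balaban-t4-ne7-p1-g100/ROAD-G100.md`
§2.4: gen 99's `NE7EnergySliceFullGaugeSplit.exists_fullGauge_split_of_tangent` realises the corner data of the slice gauge function by a SPIKE `spikeW M (M^d • framePotW X)` — an existence
device with no usable bound (height `M^d·framePotW`); the (S1) iteration needs a gauge function whose SIZE is controlled (it enters the BCH junk and `ad_ζ(F_W − 1)`).  THIS FILE replaces the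
spike by the nested covariant block-constant extension and re-proves the split for the general input `dirIter T ∈ gaugeDir_V(coarse)` (the shape of every iterate `T(u)` of memo §2.1).
INPUTS BY NAME: `NE3CovariantBlockMean.bmeanW ∕ bmeanIterW` (the nested transported mean), `AveragingDeficitChartCalculus.cavg`, `SmoothRefineBlocks.blk ∕ res`,
`NE7BalabanGaugeTransport.QbarIter_gaugeDir_eq_bmean` (`Q̄(gaugeDir W μ) = gaugeDir_V(bmeanIterW μ)`), `NE3TangentCovariantTower.dirIter_eq_QbarIter_add_gaugeDir`,
`NE3CovariantLineSumsTower.QbarIter_add`, `NE7MeanZeroGaugeSliceW.exists_decomposition_of_QbarIter_eq_zero` (the `Ξ_Q`-split inside `ker Q̄`), `NE3SmoothLiftW.framePotW_skew ∕ _add_period`.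
WHAT ([folklore]; 2 DATA defs `covExt`, `nestedExt`; no `def … : Prop`; 0 sorry).
§1 **`covExt L W f`** (`x ↦ Ad_{W(Γ_{L•blk x, x})}⁻¹ f(blk x)`): `bmeanW_covExt` (`bmeanW L W (covExt L W f) = f`, EXACT, every `W`), `covExt_corner`, `norm_covExt`, `covExt_skew`, `covExt_add_period`.
§2 **`nestedExt L k W g`** (`nestedExt 0 = id`, `nestedExt (k+1) W = covExt L W ∘ nestedExt k (cavg L W)`): **`bmeanIterW_nestedExt`** (`bmeanIterW L k W (nestedExt L k W g) = g`, EXACT, every `W`),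
   `nestedExt_corner` (`nestedExt L k W g (L^k • z) = g z`), and in the multi-level small-field class `norm_nestedExt_le` (`≤ sup‖g‖`), `nestedExt_skew`, `nestedExt_add_period`
   (period `tower L N k` from an `N`-periodic `g`).
§3 **`exists_fullGauge_split_of_dirIter_eq_gaugeDir`**: `W ∈` class at level `j+1`, `T` skew `(tower L N (j+1))`-periodic with `dirIter L (j+1) W T = gaugeDir (cavgIter L (j+1) W) h`, `h` skew
   `N`-periodic ⟹ `∃ ζ₁ η Ỹ`: `ζ₁ = nestedExt L (j+1) W (framePotW T − h)` (so `‖ζ₁ y‖ ≤ sup‖framePotW T − h‖`), `η ∈ Ξ_Q(W)`, `Ỹ ∈ energyBlockLandauW L N (j+1) W`,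
   `Ỹ = T + gaugeDir W ζ₁ + gaugeDir W η` pointwise — i.e. `T = Ỹ + gaugeDir W (−(ζ₁ + η))`; and `exists_fullGauge_split_general` (the p760186-shaped corollary `∃ ζ XE, … T = XE + gaugeDir W ζ`).
HONEST FRAMING (page 1): exact linear kinematics in the cell's typed class; the SIZE of `η` is NOT bounded here (socket: `NE7MeanZeroGaugeSupPoincare.sup_le_of_bmeanIterW_eq_zero` with
`G = sup‖gaugeDir W η‖ = sup‖Ỹ − T − gaugeDir W ζ₁‖`; the in-block refinement of that letter and the in-block smallness of `gaugeDir W ζ₁` are part 2); NOT the nonlinear slice theorem, NOT (S1),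
NOT NE7; spine 0∕9; finite T⁴ rung (B)+1 — NOT infinite volume, NOT mass gap, NOT BetaPertH, NOT Clay.  Continuum YM on T⁴ ⇐ BetaPertH ∧ nine spine estimates (0/9 proved); BetaPertH ⇐ (D1) ∧
(D4) ∧ CAP+tail; G-an2-4 gates asym, D1 and NE2/3/4.  Text locations only: [Balaban1985Averaging] (42) p. 23, (110)–(120) pp. 31–35.
-/

set_option autoImplicit false

open scoped BigOperators Matrix.Norms.L2Operator
open Finset

namespace Summit.QuantumFields.BalabanUV.T4Continuum.NE7NestedCovariantExtension

open Literature.MathematicalPhysics.QuantumFieldTheory.Balaban1983to89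
open B7Prop1Explicit B7Prop2Explicit
open T4AveragingDeficitWall (IsUnitaryCfg IsSkewDir SmallField Ad)
open T4AveragingDeficitWallBoundary (IsPeriodicCfg periodBox)
open T4AveragingDeficitNonAbelian (hol_add_period)
open AveragingDeficitPeriodicCounting (IsPeriodicDir)
open AveragingDeficitChartCalculus (cavg)
open AveragingDeficitFermat (isPeriodicCfg_cavg)
open AveragingDeficitMultiLevelPrep (cavgIter LevelSmall tower natCast_tower_succ)
open AveragingDeficitTransport (norm_Ad_of_unitary Ad_mem_skewAdjoint)
open AveragingDeficitNearIdentity (Ad_one)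
open BlockAveragePushDirGauge (gaugeDir isPeriodicDir_gaugeDir)
open NE3TangentCovariantTower (QbarIter framePotW dirIter step_small dirIter_eq_QbarIter_add_gaugeDir)
open NE3TangentCovariantStructure (gaugeDir_add_fun)
open NE3CovariantBlockMean (bmeanW bmeanIterW bmeanIterW_succ bmeanIterW_zero boxVec_bounds)
open NE3CovariantLineSumsTower (QbarIter_add)
open NE3LandauOrbit (gaugeDir_skew)
open NE3SmoothLiftW (framePotW_skew framePotW_add_period)
open NE3GaugeDirFrames (Ad_Ad_inv)
open NE7CornerSpikeTopDictionary (gaugeDir_sub_fun)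
open NE7BalabanGaugeTransport (QbarIter_gaugeDir_eq_bmean)
open NE7MeanZeroGaugeSliceW (energyBlockLandauW meanZeroGaugeSpaceW mem_meanZeroGaugeSpaceW_iff exists_decomposition_of_QbarIter_eq_zero)
open SmoothRefineBlocks (blk res blk_res_eq_of blk_res_smul blk_res_add_period)

noncomputable section

variable {d : ℕ} {n : Type*} [Fintype n] [DecidableEq n]

/-! ## §1 The one-level covariant block-constant extension -/

/-- **THE COVARIANT `L`-BLOCK-CONSTANT EXTENSION** of coarse data `f` at the background `W`: at the fine site `x = L•blk x + res x`,
`covExt L W f x = Ad_{W(Γ_{L•blk x, x})}⁻¹ (f (blk x))` — the value `f(blk x)` transported back from the block corner along the tree contour (so that the transported block mean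
returns exactly `f`). [folklore] -/
def covExt (L : ℕ) (W : Site d → Fin d → (Matrix n n ℂ)ˣ) (f : Site d → Matrix n n ℂ) : Site d → Matrix n n ℂ :=
  fun x => Ad (hol W ((L : ℤ) • blk L x) (treeWord (res L x)))⁻¹ (f (blk L x))

/-- **THE TRANSPORTED BLOCK MEAN OF THE EXTENSION IS THE DATUM, EXACTLY**: `bmeanW L W (covExt L W f) = f` (every `W`, `L ≥ 1`). [folklore] -/
theorem bmeanW_covExt {L : ℕ} (hL : 1 ≤ L) (W : Site d → Fin d → (Matrix n n ℂ)ˣ) (f : Site d → Matrix n n ℂ) : bmeanW L W (covExt L W f) = f := by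
  funext z
  unfold bmeanW
  have hterm : ∀ r : Fin d → Fin L,
      Ad (hol W ((L : ℤ) • z) (treeWord (boxVec L r))) (covExt L W f ((L : ℤ) • z + boxVec L r)) = f z := by
    intro r
    obtain ⟨hb, hr⟩ := blk_res_eq_of hL (y := (L : ℤ) • z + boxVec L r) rfl (fun i => (boxVec_bounds L r i).1) (fun i => (boxVec_bounds L r i).2)
    unfold covExt
    rw [hb, hr, Ad_Ad_inv]
  simp_rw [hterm]
  rw [← Finset.sum_smul, sum_weights L hL, one_smul]

/-- at a corner the extension is the datum: `covExt L W f (L•y) = f y`. [folklore] -/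
theorem covExt_corner {L : ℕ} (hL : 1 ≤ L) (W : Site d → Fin d → (Matrix n n ℂ)ˣ) (f : Site d → Matrix n n ℂ) (y : Site d) :
    covExt L W f ((L : ℤ) • y) = f y := by
  obtain ⟨hb, hr⟩ := blk_res_smul hL y
  unfold covExt
  rw [hb, hr, treeWord_zero, hol_nil, inv_one, Ad_one]

/-- the extension is an isometry of values: `‖covExt L W f x‖ = ‖f (blk x)‖` (`W` unitary). [folklore] -/
theorem norm_covExt (L : ℕ) {W : Site d → Fin d → (Matrix n n ℂ)ˣ} (hWu : IsUnitaryCfg W) (f : Site d → Matrix n n ℂ) (x : Site d) :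
    ‖covExt L W f x‖ = ‖f (blk L x)‖ :=
  norm_Ad_of_unitary ((unitaryUnits _).inv_mem (hol_mem_of hWu _ _)) _

/-- the extension of skew data is skew (`W` unitary). [folklore] -/
theorem covExt_skew (L : ℕ) {W : Site d → Fin d → (Matrix n n ℂ)ˣ} (hWu : IsUnitaryCfg W) {f : Site d → Matrix n n ℂ}
    (hf : ∀ z, f z ∈ skewAdjoint (Matrix n n ℂ)) (x : Site d) : covExt L W f x ∈ skewAdjoint (Matrix n n ℂ) :=
  Ad_mem_skewAdjoint ((unitaryUnits _).inv_mem (hol_mem_of hWu _ _)) (hf _)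

/-- the extension of `P`-periodic data at an `L·P`-periodic background is `L·P`-periodic. [folklore] -/
theorem covExt_add_period {L : ℕ} (hL : 1 ≤ L) {W : Site d → Fin d → (Matrix n n ℂ)ˣ} {P : ℕ} (hWP : IsPeriodicCfg W ((L : ℤ) * P))
    {f : Site d → Matrix n n ℂ} (hf : ∀ (z : Site d) (i : Fin d), f (z + (P : ℤ) • e i) = f z) (x : Site d) (i : Fin d) :
    covExt L W f (x + ((L : ℤ) * P) • e i) = covExt L W f x := by
  obtain ⟨hb, hr⟩ := blk_res_add_period hL x (P : ℤ) i
  unfold covExt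
  rw [hb, hr, hf, smul_add, smul_smul, hol_add_period hWP i]

/-! ## §2 The nested extension through the tower -/

/-- **THE NESTED COVARIANT BLOCK-CONSTANT EXTENSION** of coarse data `g` through `k` levels at the background `W`: `nestedExt L 0 W g = g`,
`nestedExt L (k+1) W g = covExt L W (nestedExt L k (cavg L W) g)` — extend one level at a time at the successive averaged backgrounds, innermost level last (the mirror image of
`bmeanIterW`'s recursion). [folklore] -/
def nestedExt (L : ℕ) : ℕ → (Site d → Fin d → (Matrix n n ℂ)ˣ) → (Site d → Matrix n n ℂ) → Site d → Matrix n n ℂ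
  | 0, _, g => g
  | k + 1, W, g => covExt L W (nestedExt L k (cavg L W) g)

/-- `nestedExt L 0 W g = g`. [folklore] -/
@[simp] theorem nestedExt_zero (L : ℕ) (W : Site d → Fin d → (Matrix n n ℂ)ˣ) (g : Site d → Matrix n n ℂ) : nestedExt L 0 W g = g := rfl

/-- the recursion of `nestedExt`. [folklore] -/
theorem nestedExt_succ (L k : ℕ) (W : Site d → Fin d → (Matrix n n ℂ)ˣ) (g : Site d → Matrix n n ℂ) :
    nestedExt L (k + 1) W g = covExt L W (nestedExt L k (cavg L W) g) := rfl

/-- **THE NESTED TRANSPORTED BLOCK MEAN OF THE NESTED EXTENSION IS THE DATUM, EXACTLY**: `bmeanIterW L k W (nestedExt L k W g) = g` (every `W`, every `k`, `L ≥ 1`) — no spike,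
no inversion. [folklore] -/
theorem bmeanIterW_nestedExt {L : ℕ} (hL : 1 ≤ L) : ∀ (k : ℕ) (W : Site d → Fin d → (Matrix n n ℂ)ˣ) (g : Site d → Matrix n n ℂ),
    bmeanIterW L k W (nestedExt L k W g) = g
  | 0, W, g => rfl
  | k + 1, W, g => by rw [bmeanIterW_succ, nestedExt_succ, bmeanW_covExt hL, bmeanIterW_nestedExt hL k]

/-- at the top corners the nested extension is the datum: `nestedExt L k W g (L^k • z) = g z`. [folklore] -/
theorem nestedExt_corner {L : ℕ} (hL : 1 ≤ L) : ∀ (k : ℕ) (W : Site d → Fin d → (Matrix n n ℂ)ˣ) (g : Site d → Matrix n n ℂ) (z : Site d),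
    nestedExt L k W g (((L : ℤ) ^ k) • z) = g z
  | 0, W, g, z => by simp
  | k + 1, W, g, z => by
      rw [nestedExt_succ, pow_succ', ← smul_smul, covExt_corner hL, nestedExt_corner hL k]

/-- **SUP NORM**: in the multi-level small-field class (`W` unitary, `0 ≤ x`, `LevelSmall d L j x`, `SmallField W x`; so that every averaged background of the tower is unitary),
`‖g‖ ≤ s` everywhere ⟹ `‖nestedExt L (j+1) W g‖ ≤ s` everywhere. [folklore] -/
theorem norm_nestedExt_le [Nonempty n] {L : ℕ} (hL : 1 ≤ L) :
    ∀ (j : ℕ) {W : Site d → Fin d → (Matrix n n ℂ)ˣ} {x : ℝ}, IsUnitaryCfg W → 0 ≤ x → LevelSmall d L j x → SmallField W x →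
    ∀ {g : Site d → Matrix n n ℂ} {s : ℝ}, (∀ z, ‖g z‖ ≤ s) → ∀ y, ‖nestedExt L (j + 1) W g y‖ ≤ s := by
  intro j
  induction j with
  | zero =>
      intro W x hWu _ _ _ g s hg y
      rw [nestedExt_succ, norm_covExt L hWu, nestedExt_zero]
      exact hg _
  | succ j ih =>
      intro W x hWu hx hs hWx g s hg y
      obtain ⟨-, hW₁u, hr0, hW₁x⟩ := step_small hL hWu hx hs.1 hWx
      rw [nestedExt_succ, norm_covExt L hWu]
      exact ih hW₁u hr0 hs.2 hW₁x hg _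

/-- **SKEWNESS** in the same class: skew `g` ⟹ skew `nestedExt L (j+1) W g`. [folklore] -/
theorem nestedExt_skew [Nonempty n] {L : ℕ} (hL : 1 ≤ L) :
    ∀ (j : ℕ) {W : Site d → Fin d → (Matrix n n ℂ)ˣ} {x : ℝ}, IsUnitaryCfg W → 0 ≤ x → LevelSmall d L j x → SmallField W x →
    ∀ {g : Site d → Matrix n n ℂ}, (∀ z, g z ∈ skewAdjoint (Matrix n n ℂ)) → ∀ y, nestedExt L (j + 1) W g y ∈ skewAdjoint (Matrix n n ℂ) := by
  intro j
  induction j with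
  | zero =>
      intro W x hWu _ _ _ g hg y
      rw [nestedExt_succ]
      exact covExt_skew L hWu (fun z => by rw [nestedExt_zero]; exact hg z) y
  | succ j ih =>
      intro W x hWu hx hs hWx g hg y
      obtain ⟨-, hW₁u, hr0, hW₁x⟩ := step_small hL hWu hx hs.1 hWx
      rw [nestedExt_succ]
      exact covExt_skew L hWu (fun z => ih hW₁u hr0 hs.2 hW₁x hg z) y

/-- **PERIODICITY**: `W` of period `tower L N k` and `g` of period `N` ⟹ `nestedExt L k W g` of period `tower L N k` (every `W`, `L ≥ 1`). [folklore] -/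
theorem nestedExt_add_period {L : ℕ} (hL : 1 ≤ L) {N : ℕ} : ∀ (k : ℕ) {W : Site d → Fin d → (Matrix n n ℂ)ˣ},
    IsPeriodicCfg W ((tower L N k : ℕ) : ℤ) → ∀ {g : Site d → Matrix n n ℂ}, (∀ (z : Site d) (i : Fin d), g (z + (N : ℤ) • e i) = g z) →
    ∀ (y : Site d) (i : Fin d), nestedExt L k W g (y + ((tower L N k : ℕ) : ℤ) • e i) = nestedExt L k W g y
  | 0, W, _, g, hg, y, i => by simpa [tower] using hg y i
  | k + 1, W, hWP, g, hg, y, i => by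
      have hWP' : IsPeriodicCfg W ((L : ℤ) * (tower L N k : ℕ)) := by rw [← natCast_tower_succ]; exact hWP
      have hW₁P : IsPeriodicCfg (cavg L W) ((tower L N k : ℕ) : ℤ) := isPeriodicCfg_cavg L _ hWP'
      have ih := nestedExt_add_period hL k hW₁P hg
      rw [nestedExt_succ, natCast_tower_succ]
      exact covExt_add_period hL hWP' ih y i

/-! ## §3 The linear `𝒯_E`-split over the full gauge group with the spike-free gauge function -/

/-- **THE SPIKE-FREE LINEAR SLICE SPLIT** (multi-level small-field class at level `j+1`: `W` unitary of period `tower L N (j+1)`, `0 ≤ x`, `LevelSmall d L j x`, `SmallField W x`).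
For a skew `(tower L N (j+1))`-periodic direction `T` whose `(j+1)`-fold linearised average is a COARSE PURE GAUGE, `dirIter L (j+1) W T = gaugeDir (cavgIter L (j+1) W) h` with `h` skew and
`N`-periodic, put `ζ₁ := nestedExt L (j+1) W (framePotW L (j+1) W T − h)`.  Then `Q̄(T + gaugeDir W ζ₁) = 0`, and there are `η ∈ Ξ_Q(W)` and `Ỹ ∈ 𝒯_E(W) = energyBlockLandauW L N (j+1) W`
with `Ỹ = T + gaugeDir W ζ₁ + gaugeDir W η` pointwise; moreover `‖ζ₁ y‖ ≤ s` for every `s` bounding `‖framePotW T z − h z‖` uniformly, and `ζ₁` is skew and `(tower L N (j+1))`-periodic.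
(Tangent `T` is the case `h = 0`; `NE7EnergySliceFullGaugeSplit` is the same split with a spike in place of `ζ₁`.) [folklore] -/
theorem exists_fullGauge_split_of_dirIter_eq_gaugeDir [Nonempty n] {L N : ℕ} [NeZero N] (hL : 1 ≤ L) (j : ℕ)
    {W : Site d → Fin d → (Matrix n n ℂ)ˣ} {x : ℝ} (hWu : IsUnitaryCfg W) (hWP : IsPeriodicCfg W ((tower L N (j + 1) : ℕ) : ℤ))
    (hx : 0 ≤ x) (hs : LevelSmall d L j x) (hWx : SmallField W x)
    {T : Site d → Fin d → Matrix n n ℂ} (hT : IsSkewDir T) (hTP : IsPeriodicDir T ((tower L N (j + 1) : ℕ) : ℤ))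
    {h : Site d → Matrix n n ℂ} (hh : ∀ z, h z ∈ skewAdjoint (Matrix n n ℂ)) (hhP : ∀ (z : Site d) (i : Fin d), h (z + (N : ℤ) • e i) = h z)
    (hdir : dirIter L (j + 1) W T = gaugeDir (cavgIter L (j + 1) W) h) :
    ∃ (η : Site d → Matrix n n ℂ) (Yt : Site d → Fin d → Matrix n n ℂ),
      η ∈ meanZeroGaugeSpaceW (d := d) (n := n) L (j + 1) W (tower L N (j + 1)) ∧
      Yt ∈ energyBlockLandauW (d := d) (n := n) L N (j + 1) W ∧
      (∀ y, nestedExt L (j + 1) W (fun z => framePotW L (j + 1) W T z - h z) y ∈ skewAdjoint (Matrix n n ℂ)) ∧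
      (∀ (y : Site d) (i : Fin d), nestedExt L (j + 1) W (fun z => framePotW L (j + 1) W T z - h z) (y + ((tower L N (j + 1) : ℕ) : ℤ) • e i)
          = nestedExt L (j + 1) W (fun z => framePotW L (j + 1) W T z - h z) y) ∧
      (∀ s : ℝ, (∀ z, ‖framePotW L (j + 1) W T z - h z‖ ≤ s) → ∀ y, ‖nestedExt L (j + 1) W (fun z => framePotW L (j + 1) W T z - h z) y‖ ≤ s) ∧
      ∀ y μ, Yt y μ = T y μ + gaugeDir W (nestedExt L (j + 1) W (fun z => framePotW L (j + 1) W T z - h z)) y μ + gaugeDir W η y μ := by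
  set g : Site d → Matrix n n ℂ := fun z => framePotW L (j + 1) W T z - h z with hg
  set ζ₁ := nestedExt L (j + 1) W g with hζ₁
  -- `g` is skew and `N`-periodic; `ζ₁` is skew, periodic, sup-bounded
  have hgs : ∀ z, g z ∈ skewAdjoint (Matrix n n ℂ) := fun z =>
    (skewAdjoint _).sub_mem (framePotW_skew hL j hWu hx hs hWx hT z) (hh z)
  have hgP : ∀ (z : Site d) (i : Fin d), g (z + (N : ℤ) • e i) = g z := fun z i => by
    simp only [hg, framePotW_add_period L j hWP hTP z i, hhP z i]
  have hζs : ∀ y, ζ₁ y ∈ skewAdjoint (Matrix n n ℂ) := nestedExt_skew hL j hWu hx hs hWx hgs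
  have hζP : ∀ (y : Site d) (i : Fin d), ζ₁ (y + ((tower L N (j + 1) : ℕ) : ℤ) • e i) = ζ₁ y := nestedExt_add_period hL (j + 1) hWP hgP
  have hζb : ∀ s : ℝ, (∀ z, ‖g z‖ ≤ s) → ∀ y, ‖ζ₁ y‖ ≤ s := fun s hsb => norm_nestedExt_le hL j hWu hx hs hWx hsb
  -- `T′ := T + gaugeDir W ζ₁` is skew, periodic and in `ker Q̄`
  have hT's : IsSkewDir (fun y μ => T y μ + gaugeDir W ζ₁ y μ) :=
    fun y μ => (skewAdjoint _).add_mem (hT y μ) (gaugeDir_skew hWu hζs y μ)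
  have hT'P : IsPeriodicDir (fun y μ => T y μ + gaugeDir W ζ₁ y μ) ((tower L N (j + 1) : ℕ) : ℤ) := by
    intro y i μ
    have h1 := hTP y i μ
    have h2 := isPeriodicDir_gaugeDir hWP hζP y i μ
    simp only [h1, h2]
  have hQT : QbarIter L (j + 1) W T = fun z κ => gaugeDir (cavgIter L (j + 1) W) h z κ - gaugeDir (cavgIter L (j + 1) W) (framePotW L (j + 1) W T) z κ := by
    have hstr := dirIter_eq_QbarIter_add_gaugeDir (M := N) hL j hWu hWP hx hs hWx hT hTP
    rw [hdir] at hstr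
    funext z κ
    have := congr_fun (congr_fun hstr z) κ
    rw [this]; abel
  have hQζ : QbarIter L (j + 1) W (gaugeDir W ζ₁) = fun z κ => gaugeDir (cavgIter L (j + 1) W) g z κ := by
    rw [QbarIter_gaugeDir_eq_bmean hL j hWu hWP hx hs hWx hζs hζP, hζ₁, bmeanIterW_nestedExt hL]
  have hT'Q : QbarIter L (j + 1) W (fun y μ => T y μ + gaugeDir W ζ₁ y μ) = 0 := by
    rw [QbarIter_add hL j hWu hx hs hWx, hQT, hQζ]
    funext z κ
    simp only [Pi.zero_apply, hg]
    rw [← gaugeDir_sub_fun]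
    abel
  -- the `Ξ_Q`-split inside `ker Q̄`
  obtain ⟨η, hη, hE⟩ := exists_decomposition_of_QbarIter_eq_zero hL j hWu hWP hx hs hWx hT's hT'P hT'Q
  exact ⟨η, _, hη, hE, hζs, hζP, hζb, fun y μ => rfl⟩

/-- **THE SPLIT IN p760186's SHAPE, SPIKE-FREE**: under the same hypotheses `∃ ζ XE`, `ζ` skew `(tower)`-periodic, `XE ∈ energyBlockLandauW L N (j+1) W`, `T = XE + gaugeDir W ζ` pointwise,
with `ζ = −(nestedExt (framePotW T − h) + η)`, `η ∈ Ξ_Q(W)`. [folklore] -/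
theorem exists_fullGauge_split_general [Nonempty n] {L N : ℕ} [NeZero N] (hL : 1 ≤ L) (j : ℕ)
    {W : Site d → Fin d → (Matrix n n ℂ)ˣ} {x : ℝ} (hWu : IsUnitaryCfg W) (hWP : IsPeriodicCfg W ((tower L N (j + 1) : ℕ) : ℤ))
    (hx : 0 ≤ x) (hs : LevelSmall d L j x) (hWx : SmallField W x)
    {T : Site d → Fin d → Matrix n n ℂ} (hT : IsSkewDir T) (hTP : IsPeriodicDir T ((tower L N (j + 1) : ℕ) : ℤ))
    {h : Site d → Matrix n n ℂ} (hh : ∀ z, h z ∈ skewAdjoint (Matrix n n ℂ)) (hhP : ∀ (z : Site d) (i : Fin d), h (z + (N : ℤ) • e i) = h z)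
    (hdir : dirIter L (j + 1) W T = gaugeDir (cavgIter L (j + 1) W) h) :
    ∃ (ζ : Site d → Matrix n n ℂ) (XE : Site d → Fin d → Matrix n n ℂ),
      (∀ y, ζ y ∈ skewAdjoint (Matrix n n ℂ)) ∧ (∀ (y : Site d) (i : Fin d), ζ (y + ((tower L N (j + 1) : ℕ) : ℤ) • e i) = ζ y) ∧
      XE ∈ energyBlockLandauW (d := d) (n := n) L N (j + 1) W ∧
      (∃ η ∈ meanZeroGaugeSpaceW (d := d) (n := n) L (j + 1) W (tower L N (j + 1)),
        ∀ y, ζ y = -(nestedExt L (j + 1) W (fun z => framePotW L (j + 1) W T z - h z) y + η y)) ∧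
      ∀ y μ, T y μ = XE y μ + gaugeDir W ζ y μ := by
  obtain ⟨η, Yt, hη, hYt, hζs, hζP, -, hsplit⟩ :=
    exists_fullGauge_split_of_dirIter_eq_gaugeDir hL j hWu hWP hx hs hWx hT hTP hh hhP hdir
  obtain ⟨⟨hηP, hηs⟩, -⟩ := mem_meanZeroGaugeSpaceW_iff.mp hη
  set ζ₁ := nestedExt L (j + 1) W (fun z => framePotW L (j + 1) W T z - h z) with hζ₁
  refine ⟨fun y => -(ζ₁ y + η y), Yt, fun y => (skewAdjoint _).neg_mem ((skewAdjoint _).add_mem (hζs y) (hηs y)), fun y i => ?_, hYt,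
    ⟨η, hη, fun y => rfl⟩, fun y μ => ?_⟩
  · simp only [hζP y i, hηP y i]
  · have hneg : gaugeDir W (fun y => -(ζ₁ y + η y)) y μ = -(gaugeDir W ζ₁ y μ + gaugeDir W η y μ) := by
      have e1 : (fun y => -(ζ₁ y + η y)) = fun y => (-1 : ℝ) • (ζ₁ y + η y) := funext fun y => by rw [neg_one_smul]
      rw [e1, NE7CornerSpikeTopDictionary.gaugeDir_smul_fun, gaugeDir_add_fun, neg_one_smul]
    rw [hneg, hsplit y μ]
    abel

end

end Summit.QuantumFields.BalabanUV.T4Continuum.NE7NestedCovariantExtension
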